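import Summits.AtomisticToContinuum.FouriersLaw.Theses.BondHeatUncertainty
import Summits.AtomisticToContinuum.FouriersLaw.Theses.BoundaryEscapeDeficit

/-!
# `SubdiffusiveBondHeat`, line `bath-bond-deficit-integral`: the Ohmic floor from route `BoundaryEscapeDeficit`

Cross-route support for crux `stmt-AtomisticToContinuum-9120` (`BondHeatUncertainty.SubdiffusiveBondHeat`), line
`bath-bond-deficit-integral`, registered stub `stub_ohmicFloor`: the ESCAPE DEFICIT of the `N`-site pinned anharmonic
chain `P = pinnedChain ω₂ lam β γ` with both Langevin baths at temperature `T`,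

  `E_N = 1 - (γ/T²) ∫_{(0,∞)} K_N(u) du`,  `K_N(u) = ∫ (p₀² - T) · P_u(p₀² - T) dμ_T^N`

(VERBATIM the `let K`, `let E` of route `BoundaryEscapeDeficit`), satisfies the Ohmic floor `E_N ≤ C₁/N` for
`N ≥ N₀`.  Unconditionally this is open-problem calibre (bounded response seen from the thermostatted site: barrier
`HasBoundedResponse` met head-on; false at the harmonic member `lam = β = 0`).  This file lands the two CONDITIONAL
bridges from the sibling route, with the stub's conclusion stated verbatim:

* `stub_ohmicFloor_of_escapeLaw` — from the route TARGET `BoundaryEscapeDeficit.EscapeLaw`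
  (`stmt-AtomisticToContinuum-12234`: `(N-1) γ E_N → κ_b > 0`): a convergent sequence is eventually `≤ |κ_b| + 1`,
  so `E_N ≤ (|κ_b|+1)/((N-1)γ) ≤ 2(|κ_b|+1)/(γN)` for `N ≥ 2` large.
* `stub_ohmicFloor_of_tail_crossover` — from the UPPER halves of the cruxes `BoundaryEscapeDeficit.HalfChainTailLaw`
  (`stmt-AtomisticToContinuum-12235`: `c/√t ≤ 1 - θ_M(t) ≤ C/√t` eventually in `M`, for `t ≥ t₀`) and
  `BoundaryEscapeDeficit.DiffusiveCrossover` (`stmt-AtomisticToContinuum-12236`: `E_N ≤ C₂ (1 - θ_M(a₀N²))`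
  eventually in `M`, for all large `N`): at one common large `M`, `E_N ≤ max(C₂,0) · max(C,0)/(√a₀ N)`; the lower
  tail bound is used only for the sign `1 - θ_M ≥ 0`.

Both are pure real/filter arithmetic over abstract sequences (`floor_of_tendsto`, `floor_of_tail_crossover`),
instantiated at the verbatim objects.

**Junk point (checked, recorded).** `∫ u in Set.Ioi 0, K_N u` is a Bochner integral against `volume.restrict (Ioi 0)`:
it is `0` whenever `K_N ∉ L¹((0,∞))` (`MeasureTheory.integral_undef`), in which case `E_N = 1` and the stub's
conclusion `1 ≤ C₁/N` fails for every `N > C₁`.  So the UNCONDITIONAL stub, as typed, also asserts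
`K_N ∈ L¹((0,∞))` for all large `N` (expected from the proved exponential ergodicity at fixed `N`, but not free);
`integrableOn_of_ohmicFloor` below records this mechanically.  The bridges are unaffected: `EscapeLaw` and
`DiffusiveCrossover` speak about the very same expression `E_N`, junk value included.

Nothing here closes an item; the hypotheses are the route decls BY NAME.  Ledger filing: a
`--supports stmt-AtomisticToContinuum-9120` helper must prove a REGISTERED stub verbatim (gate rule
`supports.stub-mismatch`), and these bridges are conditional, so the file is filed `--supports stmt-AtomisticToContinuum-12234`
(its hypothesis item `EscapeLaw`, the named blocker of `stub_ohmicFloor`); the stub itself stays open on crux 9120.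
-/

noncomputable section

open MeasureTheory Filter Topology Set
open Literature.MathematicalPhysics.KineticTheory.HeatConduction

namespace Summit.AtomisticToContinuum.FouriersLaw.Theorems.SubdiffusiveBondHeat

open Summit.AtomisticToContinuum.FouriersLaw.Theses.BoundaryEscapeDeficit (EscapeLaw HalfChainTailLaw
  DiffusiveCrossover)

/-! ## Abstract real/filter arithmetic -/

/-- If `(N-1) γ E_N` converges (to anything) and `γ > 0`, then `E_N ≤ C₁/N` for all large `N`, with
`C₁ = 2(|κ_b|+1)/γ`: eventually `(N-1) γ E_N ≤ |κ_b| + 1`, and `1/(N-1) ≤ 2/N` for `N ≥ 2`. [folklore] -/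
theorem floor_of_tendsto {E : ℕ → ℝ} {γ κb : ℝ} (hγ : 0 < γ)
    (hlim : Tendsto (fun N : ℕ => ((N : ℝ) - 1) * γ * E N) atTop (𝓝 κb)) :
    ∃ C₁ : ℝ, ∃ N₀ : ℕ, ∀ N : ℕ, N₀ ≤ N → E N ≤ C₁ / (N : ℝ) := by
  have hlt : κb < |κb| + 1 := by linarith [le_abs_self κb]
  have hev : ∀ᶠ N : ℕ in atTop, ((N : ℝ) - 1) * γ * E N ≤ |κb| + 1 :=
    (hlim.eventually (Iic_mem_nhds hlt)).mono fun N hN => hN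
  obtain ⟨N₁, hN₁⟩ := eventually_atTop.1 hev
  refine ⟨2 * (|κb| + 1) / γ, max N₁ 2, fun N hN => ?_⟩
  have hN1 : N₁ ≤ N := le_trans (le_max_left _ _) hN
  have hN2 : 2 ≤ N := le_trans (le_max_right _ _) hN
  have hNr : (2 : ℝ) ≤ N := by exact_mod_cast hN2
  have hNpos : (0 : ℝ) < N := by linarith
  have hb := hN₁ N hN1
  have hpos : 0 < ((N : ℝ) - 1) * γ := mul_pos (by linarith) hγ
  have hk : 0 ≤ |κb| + 1 := by positivity
  have h1 : E N ≤ (|κb| + 1) / (((N : ℝ) - 1) * γ) := by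
    rw [le_div_iff₀ hpos]
    calc E N * (((N : ℝ) - 1) * γ) = ((N : ℝ) - 1) * γ * E N := by ring
      _ ≤ |κb| + 1 := hb
  have h2 : (|κb| + 1) / (((N : ℝ) - 1) * γ) ≤ 2 * (|κb| + 1) / γ / (N : ℝ) := by
    rw [div_le_div_iff₀ hpos hNpos]
    have : (N : ℝ) ≤ 2 * ((N : ℝ) - 1) := by linarith
    calc (|κb| + 1) * (N : ℝ) ≤ (|κb| + 1) * (2 * ((N : ℝ) - 1)) := mul_le_mul_of_nonneg_left this hk
      _ = 2 * (|κb| + 1) / γ * (((N : ℝ) - 1) * γ) := by field_simp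
  exact h1.trans h2

/-- If, for `t ≥ t₀`, eventually in `M` one has `c/√t ≤ 1 - θ_M(t) ≤ C/√t` (`c > 0`), and for all large `N`,
eventually in `M`, `E_N ≤ C₂ (1 - θ_M(a₀ N²))` (`a₀ > 0`), then `E_N ≤ C₁/N` for all large `N`, with
`C₁ = max(C₂,0) · max(C,0)/√a₀`: pick one `M` in the intersection of the two eventual sets at `t = a₀N² ≥ t₀` and use
`√(a₀N²) = √a₀ · N`. [folklore] -/
theorem floor_of_tail_crossover {θ : ℕ → ℝ → ℝ} {E : ℕ → ℝ} {c C t₀ a₀ C₂ : ℝ} (hc : 0 < c) (ha₀ : 0 < a₀)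
    (htail : ∀ t : ℝ, t₀ ≤ t → ∀ᶠ M : ℕ in atTop,
      c / Real.sqrt t ≤ 1 - θ M t ∧ 1 - θ M t ≤ C / Real.sqrt t)
    (hcross : ∀ᶠ N : ℕ in atTop, ∀ᶠ M : ℕ in atTop, E N ≤ C₂ * (1 - θ M (a₀ * (N : ℝ) ^ 2))) :
    ∃ C₁ : ℝ, ∃ N₀ : ℕ, ∀ N : ℕ, N₀ ≤ N → E N ≤ C₁ / (N : ℝ) := by
  have hNev : ∀ᶠ N : ℕ in atTop, t₀ ≤ a₀ * (N : ℝ) ^ 2 := by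
    have : Tendsto (fun N : ℕ => a₀ * (N : ℝ) ^ 2) atTop atTop := by
      apply Tendsto.const_mul_atTop ha₀
      exact (tendsto_pow_atTop two_ne_zero).comp tendsto_natCast_atTop_atTop
    exact this.eventually_ge_atTop t₀
  obtain ⟨N₁, hN₁⟩ := eventually_atTop.1 (hcross.and hNev)
  refine ⟨max C₂ 0 * (max C 0 / Real.sqrt a₀), max N₁ 1, fun N hN => ?_⟩
  have hNN₁ : N₁ ≤ N := le_trans (le_max_left _ _) hN
  have hN1 : 1 ≤ N := le_trans (le_max_right _ _) hN
  have hNr : (0 : ℝ) < N := by exact_mod_cast hN1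
  obtain ⟨hcrossN, htN⟩ := hN₁ N hNN₁
  obtain ⟨M, hup, hlow, htailM⟩ := (hcrossN.and (htail _ htN)).exists
  have hsq : Real.sqrt (a₀ * (N : ℝ) ^ 2) = Real.sqrt a₀ * (N : ℝ) := by
    rw [Real.sqrt_mul ha₀.le, Real.sqrt_sq hNr.le]
  have hdef0 : 0 ≤ 1 - θ M (a₀ * (N : ℝ) ^ 2) :=
    le_trans (div_nonneg hc.le (Real.sqrt_nonneg _)) hlow
  calc E N ≤ C₂ * (1 - θ M (a₀ * (N : ℝ) ^ 2)) := hup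
    _ ≤ max C₂ 0 * (1 - θ M (a₀ * (N : ℝ) ^ 2)) := mul_le_mul_of_nonneg_right (le_max_left _ _) hdef0
    _ ≤ max C₂ 0 * (C / Real.sqrt (a₀ * (N : ℝ) ^ 2)) := mul_le_mul_of_nonneg_left htailM (le_max_right _ _)
    _ ≤ max C₂ 0 * (max C 0 / Real.sqrt (a₀ * (N : ℝ) ^ 2)) :=
        mul_le_mul_of_nonneg_left (div_le_div_of_nonneg_right (le_max_left _ _) (Real.sqrt_nonneg _))
          (le_max_right _ _)
    _ = max C₂ 0 * (max C 0 / Real.sqrt a₀) / (N : ℝ) := by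
        rw [hsq]; field_simp

/-- The junk point, mechanically: `∫ u in Ioi 0, K N u` is the Bochner integral, equal to `0` when `K N` is not
integrable on `(0,∞)`; so a floor `1 - (γ/T²)∫_{(0,∞)} K_N ≤ C₁/N` at some `N > C₁` FORCES `K_N ∈ L¹((0,∞))`.
(Hence the unconditional stub, as typed, carries this integrability as silent content.) [folklore] -/
theorem integrableOn_of_ohmicFloor {K : ℕ → ℝ → ℝ} {γ T C₁ : ℝ} {N : ℕ} (hN : C₁ < N)
    (hfloor : 1 - γ / T ^ 2 * (∫ u in Set.Ioi (0 : ℝ), K N u) ≤ C₁ / (N : ℝ)) :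
    IntegrableOn (K N) (Set.Ioi 0) := by
  by_contra hK
  have h0 : ∫ u in Set.Ioi (0 : ℝ), K N u = 0 := integral_undef hK
  rw [h0, mul_zero, sub_zero] at hfloor
  rcases Nat.eq_zero_or_pos N with h | h
  · subst h
    norm_num at hfloor
  · have hNr : (0 : ℝ) < N := by exact_mod_cast h
    rw [le_div_iff₀ hNr, one_mul] at hfloor
    linarith

/-! ## The two conditional bridges (conclusion = the registered signature of `stub_ohmicFloor`, verbatim) -/

/-- **Ohmic floor from the escape law** (conditional on `BoundaryEscapeDeficit.EscapeLaw`,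
`stmt-AtomisticToContinuum-12234`, UNPROVED — taken as a hypothesis by name).  The conclusion is the registered
signature of `stub_ohmicFloor` of line `bath-bond-deficit-integral` (crux `stmt-AtomisticToContinuum-9120`),
verbatim: `E_N = 1 - (γ/T²)∫_{(0,∞)} K_N ≤ C₁/N` for `N ≥ N₀`.  Proof: `EscapeLaw` gives `(N-1) γ E_N → κ_b`;
apply `floor_of_tendsto`. [folklore] -/
theorem stub_ohmicFloor_of_escapeLaw (h : EscapeLaw) :
    ∀ ω₂ lam β γ : ℝ, 0 < ω₂ → 0 < lam → 0 < β → 0 < γ → ∀ T : ℝ, 0 < T →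
      ∃ C₁ : ℝ, ∃ N₀ : ℕ, ∀ N : ℕ, N₀ ≤ N →
        1 - γ / T ^ 2 * (∫ u in Set.Ioi (0 : ℝ),
          if h : 0 < N then
            ∫ z, ((z.2 ⟨0, h⟩) ^ 2 - T) *
                (∫ y, ((y.2 ⟨0, h⟩) ^ 2 - T) ∂((pinnedChain ω₂ lam β γ).transitionKernel N T T u.toNNReal z))
              ∂((pinnedChain ω₂ lam β γ).gibbsMeasure N T)
          else 0) ≤ C₁ / (N : ℝ) := by
  intro ω₂ lam β γ hω hl hβ hγ T hT
  obtain ⟨κb, -, hlim⟩ := h ω₂ lam β γ hω hl hβ hγ T hT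
  exact floor_of_tendsto hγ hlim

/-- **Ohmic floor from tail + crossover (upper halves)** (conditional on `BoundaryEscapeDeficit.HalfChainTailLaw`,
`stmt-AtomisticToContinuum-12235`, and `BoundaryEscapeDeficit.DiffusiveCrossover`, `stmt-AtomisticToContinuum-12236`,
both UNPROVED — taken as hypotheses by name).  The conclusion is the registered signature of `stub_ohmicFloor` of line
`bath-bond-deficit-integral` (crux `stmt-AtomisticToContinuum-9120`), verbatim.  Proof: at `t = a₀N² ≥ t₀` choose one
`M` large for both statements; `E_N ≤ C₂(1 - θ_M(a₀N²)) ≤ max(C₂,0) · C/√(a₀N²) ≤ (max(C₂,0) max(C,0)/√a₀)/N`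
(`floor_of_tail_crossover`); only the UPPER crossover bound and the tail law are used (the lower tail bound for the
sign of `1 - θ_M`). [folklore] -/
theorem stub_ohmicFloor_of_tail_crossover (hT : HalfChainTailLaw) (hX : DiffusiveCrossover) :
    ∀ ω₂ lam β γ : ℝ, 0 < ω₂ → 0 < lam → 0 < β → 0 < γ → ∀ T : ℝ, 0 < T →
      ∃ C₁ : ℝ, ∃ N₀ : ℕ, ∀ N : ℕ, N₀ ≤ N →
        1 - γ / T ^ 2 * (∫ u in Set.Ioi (0 : ℝ),
          if h : 0 < N then
            ∫ z, ((z.2 ⟨0, h⟩) ^ 2 - T) *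
                (∫ y, ((y.2 ⟨0, h⟩) ^ 2 - T) ∂((pinnedChain ω₂ lam β γ).transitionKernel N T T u.toNNReal z))
              ∂((pinnedChain ω₂ lam β γ).gibbsMeasure N T)
          else 0) ≤ C₁ / (N : ℝ) := by
  intro ω₂ lam β γ hω hl hβ hγ T hT'
  obtain ⟨c, C, t₀, hc, -, htail⟩ := hT ω₂ lam β γ hω hl hβ hγ T hT'
  obtain ⟨a₀, a₁, c₂, C₂, ha₀, -, -, hcross⟩ := hX ω₂ lam β γ hω hl hβ hγ T hT'
  exact floor_of_tail_crossover hc ha₀ htail (hcross.mono fun N hN => hN.mono fun M hM => hM.2)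

end Summit.AtomisticToContinuum.FouriersLaw.Theorems.SubdiffusiveBondHeat

end
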